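import Summits.FinalStateConjecture.FinalStateConjecture.Theses.ExactKerrEnds
import Literature.Geometry.Riemannian.IsotropicCurvature
import Literature.Topology.FourManifolds.SmoothOrientation
import Literature.Geometry.Lorentzian.Volume

/-!
# Line `framed-witten` for the crux `AdmissibleMassNonneg` (stmt-FinalStateConjecture-18051)

Crux (route `ExactKerrEnds`, item #6): for every admissible vacuum datum `d` on `X` (smooth,
vacuum constraints, complete), every sole end `e` and every `M` with
`h = (1 + 2M/r) δ + o₂(r⁻¹)`, `k = o₁(r⁻²)` on `e`: `0 ≤ M` — the vacuum, `P_ADM = 0` case of the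
space-time positive mass theorem.

## The line: Witten's spinor proof on a PARALLELISED hypersurface (Parker–Taubes' form)

Technique with teeth: Witten 1981 / Parker–Taubes 1982 (Comm. Math. Phys. 84, Thm. 4.1 with
(4.1), Thm. 4.2, Lemma 4.3): a solution `ψ` of the hypersurface Dirac equation `𝒟ψ = 0`
asymptotic to a constant spinor `ψ₀` satisfies, IN VACUUM (`μ = J = 0`, so the Weitzenböck
endomorphism `ℛ = ¼(R + 2R₀₀ + 2R₀ᵢe⁰eⁱ)` vanishes identically by the constraint equations),
`∫_X |∇̂ψ|² dV_h = 4π (E|ψ₀|² + ⟨ψ₀, P_k dx⁰·dxᵏ·ψ₀⟩) = 4π M |ψ₀|²` (DR ends have `E = M`,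
`P = 0`), whence `0 ≤ M`. The only non-analytic input of the printed proof is the SPIN STRUCTURE
(Parker–Taubes p. 226: "the obstruction … is `w₂(M)`; this vanishes for orientable 3-manifolds").
The line removes it up front: on an ORIENTABLE `X` we ask for a global smooth `h`-orthonormal
frame, asymptotically Cartesian on the end (Stiefel 1935 / Whitehead 1961: orientable
3-manifolds are parallelisable; `π₂(SO(3)) = 0` aligns the frame with the chart far out) —
`stub_alignedFrame`; in such a frame spinors are `ℂ²×ℂ²`-valued FUNCTIONS, Clifford
multiplication is by Pauli matrices, and Witten's argument is scalar/vector-valued linear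
elliptic analysis on `(X, h)` for which the tree already has the tools (Sobolev and Hardy
inequalities on sole-ended AF manifolds `AFSobolev`/`EndSobolev`/`CoreSobolev`, Lax–Milgram in
the energy space `AFLinearWeakExistence`, Green's identities `GreenIdentityCompactSupport`,
radial cut-offs `EndFluxCutoff`, the Levi-Civita connection and curvature API) —
`stub_framedWitten`, stated for complete vacuum data with FINITELY MANY DR ends (Parker–Taubes'
condition (i); Bartnik–Chruściel 2005 even allow arbitrary complete ends), because the
NON-ORIENTABLE case is reduced to the orientable one on the orientation double cover, which has
two ends — `stub_orientationCover`. The composition `AdmissibleMassNonneg_of` is the case split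
on orientability (sorry-free).

Disproof used: none exists yet (no `Disproof.lean` for this crux at registration time); the
crux-attack at birth (refuter-rattack-stmt-FinalStateConjecture-18051-0) found `hd`
(admissibility: vacuum + complete) load-bearing — honoured: `stub_framedWitten` uses vacuum
(Weitzenböck without curvature term) and completeness (Lax–Milgram / vanishing of `L²` parallel
spinors), `hsole` only through `HasFinitelyManyDREnds`.
-/

noncomputable section

open scoped Manifold ContDiff Topology
open Set Filter Bundle Asymptotics Literature.Geometry.Lorentzian Literature.Topology.FourManifolds

namespace Summit.FinalStateConjecture.FinalStateConjecture.Cruxes.AdmissibleMassNonneg.FramedWitten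

/-! ## §1 Vocabulary (let-free legends of the stubs; to be landed verbatim as Literature
definitions by a `definition` work item, pattern of `TameFarFrame.lean`) -/

section Vocabulary

variable {X : Type} [TopologicalSpace X] [ChartedSpace E3 X] [IsManifold (𝓡 3) ∞ X]

/-- A **smooth global `h`-orthonormal frame** of the data `D = (h, k)` on `X`: three smooth vector
fields `F 0, F 1, F 2` (smooth sections of `TX`) which are `h_x`-orthonormal at every point — a
trivialisation of the orthonormal frame bundle of `(X, h)`, hence of its spinor bundle
(Parker–Taubes 1982, §2; Lawson–Michelsohn, *Spin Geometry*, Ch. II §1). [folklore] -/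
def IsSmoothOrthonormalFrame (D : InitialDataSet (𝓡 3) X)
    (F : Fin 3 → Π x : X, TangentSpace (𝓡 3) x) : Prop :=
  (∀ i, ContMDiff (𝓡 3) ((𝓡 3).prod 𝓘(ℝ, E3)) ∞ fun x ↦ TotalSpace.mk' E3 x (F i x)) ∧
    ∀ x, D.metric.IsOrthonormalFrame x fun i ↦ F i x

/-- The **chart pairings of a frame with the coordinate fields of the end** `e`: for `R < ‖y‖`,
`frameChartCoeff e D F i a y = h(F_i, ∂_a)` at the point `Φ(y)` of the end, where
`∂_a = dΦ_y(e_a)` is the push-forward of the `a`-th standard basis vector along the inverse chart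
`Φ = e.dataChart`; inside the ball the junk value `δ_{ia}` (invisible along `cobounded`).
(Parker–Taubes 1982, p. 232: comparison of an orthonormal coframe with `dxⁱ` on the end.)
[folklore] -/
def frameChartCoeff (e : AFEnd X) (D : InitialDataSet (𝓡 3) X)
    (F : Fin 3 → Π x : X, TangentSpace (𝓡 3) x) (i a : Fin 3) (y : E3) : ℝ :=
  if hy : e.R < ‖y‖ then
    D.h.inner (e.dataChart ⟨y, hy⟩) (F i (e.dataChart ⟨y, hy⟩))
      (mfderiv 𝓘(ℝ, E3) (𝓡 3) e.dataChart ⟨y, hy⟩ (EuclideanSpace.single a 1))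
  else if i = a then 1 else 0

/-- The frame `F` is **asymptotically Cartesian on the end `e`**: in the chart,
`h(F_i, ∂_a) - δ_{ia} = O₁(‖y‖⁻¹)`, i.e. `|∂^m (h(F_i, ∂_a) - δ_{ia})(y)| = O(‖y‖^{-1-m})` for
`m ≤ 1` (Parker–Taubes 1982, p. 232: "an orthonormal coframe `{eⁱ}` with `|eⁱ - dxⁱ| = O(1/r)`",
with the one derivative that makes the frame's connection coefficients `O(r⁻²)`, square
integrable on the end). [folklore] -/
def IsAsymptoticallyCartesian (e : AFEnd X) (D : InitialDataSet (𝓡 3) X)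
    (F : Fin 3 → Π x : X, TangentSpace (𝓡 3) x) : Prop :=
  ∀ (i a : Fin 3) (m : ℕ), m ≤ 1 →
    (fun y ↦ ‖iteratedFDeriv ℝ m
        (fun z ↦ frameChartCoeff e D F i a z - if i = a then (1 : ℝ) else 0) y‖)
      =O[Bornology.cobounded E3] fun y ↦ ‖y‖ ^ (-1 - (m : ℝ))

/-- **Finitely many Dafermos–Rodnianski ends, one of them `e`**: there are ends
`ends 0 = e, ends 1, …, ends m` of `X`, on each of which the data are strongly asymptotically
flat with some mass, whose far regions cover `X` up to a compact set (Parker–Taubes 1982, §1,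
condition (i): `M = K ∪ M₁ ∪ ⋯ ∪ M_k`, `K` compact, each `M_ℓ ≅ ℝ³ ∖ ball` asymptotically flat).
A sole end is the case `m = 0`. [folklore] -/
def HasFinitelyManyDREnds (D : InitialDataSet (𝓡 3) X) (e : AFEnd X) : Prop :=
  ∃ (m : ℕ) (ends : Fin (m + 1) → AFEnd X) (ρ : ℝ), ends 0 = e ∧
    (∀ j, ∃ Mj : ℝ, (ends j).IsStronglyAsymptoticallyFlatDR D Mj) ∧
    IsCompact (⋃ j, (ends j).far ρ)ᶜ

/-- A sole DR end gives `HasFinitelyManyDREnds` with `m = 0`. [folklore] -/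
theorem hasFinitelyManyDREnds_of_isSoleEnd {D : InitialDataSet (𝓡 3) X} {e : AFEnd X} {M : ℝ}
    (hsole : e.IsSoleEnd) (hDR : e.IsStronglyAsymptoticallyFlatDR D M) :
    HasFinitelyManyDREnds D e := by
  obtain ⟨R', -, hcpt⟩ := hsole
  refine ⟨0, fun _ ↦ e, R', rfl, fun _ ↦ ⟨M, hDR⟩, ?_⟩
  simpa [Set.iUnion_const] using hcpt

end Vocabulary

/-! ## §2 Registered stubs -/

/-- **Stub 1 (topology of the carrier): orientable data admit an asymptotically Cartesian global
orthonormal frame.** For orientable (connected, second countable) `X` carrying data `D` which are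
DR-flat on an end `e`, there is a smooth global `h`-orthonormal frame which is asymptotically
Cartesian on `e`. Route: `X` is non-compact (it has an end), so it is parallelisable
(Stiefel 1935, Comment. Math. Helv. 8 [Stiefel1935]: every orientable 3-manifold; J. H. C. Whitehead, Proc. LMS (3) 11 (1961) [Whitehead1961Immersion]: every
open orientable 3-manifold immerses in `ℝ³`, and `isParallelizable_of_isLocalDiffeomorph`);
Gram–Schmidt makes a continuous frame `h`-orthonormal and smoothing keeps it so; on the end the
Gram–Schmidt frame of `∂₁, ∂₂, ∂₃` is asymptotically Cartesian because `h - δ = O₂(r⁻¹)`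
(DR decay, `2M/r = O_∞(r⁻¹)`), and the two frames are matched across an annulus because every
map `S² → SO(3)` is null-homotopic (`π₂(SO(3)) = 0`). Size L–XL (differential topology; no
analysis). -/
theorem stub_alignedFrame :
    ∀ (X : Type) [TopologicalSpace X] [ChartedSpace E3 X] [IsManifold (𝓡 3) ∞ X] [T2Space X]
      [SecondCountableTopology X] [ConnectedSpace X],
      IsOrientable (𝓡 3) X → ∀ (D : InitialDataSet (𝓡 3) X) (e : AFEnd X) (M : ℝ),
        e.IsStronglyAsymptoticallyFlatDR D M →
          ∃ F : Fin 3 → Π x : X, TangentSpace (𝓡 3) x,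
            IsSmoothOrthonormalFrame D F ∧ IsAsymptoticallyCartesian e D F := by
  sorry

/-- **Stub 2 (the analytic heart): Witten's inequality for framed, complete vacuum data with
finitely many DR ends** (Parker–Taubes 1982, Thm. 4.1 with (4.1) and Thm. 4.2, specialised to
vacuum — `ℛ = 0` in the Weitzenböck formula (3.1)–(3.2) — and to a DR end, where `E = M`,
`P = 0`; the spin structure is the trivial one of the frame `F`, so that spinors are
`ℂ² × ℂ²`-valued functions and `𝒟 = ∑ᵢ eⁱ·∇̂ᵢ`, `∇̂ᵢ = Fᵢ + ¼ ω_{ijk} eʲeᵏ - ½ k_{ij} e⁰eʲ` with the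
frame's connection coefficients `ω_{ijk} = h(∇_{Fᵢ} Fⱼ, Fₖ)`). Architecture (the lead's supports,
see the line card): (a) vacuum Weitzenböck identity `‖𝒟φ‖₂ = ‖∇̂φ‖₂` on `C_c^∞`; (b) weighted
Poincaré/Hardy coercivity on the ends and Lax–Milgram in the completion (pattern of
`AFLinearWeakExistence`) give `ψ = ψ₀ε + ξ` with `𝒟ψ = 0`, `∇̂ξ ∈ L²`; (c) `L²` solutions of
`𝒟Ψ = 0` with `∇̂Ψ = 0` vanish (Lemma 4.3, completeness, infinite volume of the end); (d) the
boundary flux of (4.3) on coordinate spheres tends to `4π M |ψ₀|²` (asymptotically Cartesian frame,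
`hasADMEnergy`, `hasADMMomentum_zero`). Size XL (linear elliptic analysis only). -/
theorem stub_framedWitten :
    ∀ (X : Type) [TopologicalSpace X] [ChartedSpace E3 X] [IsManifold (𝓡 3) ∞ X] [T2Space X]
      [SecondCountableTopology X] [ConnectedSpace X]
      (D : InitialDataSet (𝓡 3) X) (e : AFEnd X) (M : ℝ)
      (F : Fin 3 → Π x : X, TangentSpace (𝓡 3) x),
      (∀ [D.metric.HasLeviCivita], D.IsVacuumConstraintSolution ∧ D.IsComplete) →
        e.IsStronglyAsymptoticallyFlatDR D M → HasFinitelyManyDREnds D e →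
          IsSmoothOrthonormalFrame D F → IsAsymptoticallyCartesian e D F → 0 ≤ M := by
  sorry

/-- **Stub 3 (the non-orientable case lifts to the orientation double cover).** If `X` is not
orientable, an admissible datum `d` with sole DR end `e` of mass `M` lifts along the smooth
orientation double covering `p : Y → X` (Lee, *Introduction to Smooth Manifolds*, Prop. 15.40,
Thm. 15.41) to data `D' = p^*d` on a CONNECTED (because `X` is non-orientable), orientable,
Hausdorff, second countable smooth 3-manifold `Y`: `p` is a smooth covering map and a local
isometry carrying `k` to `k`, so `D'` solves the vacuum constraints and is complete (Riemannian
coverings of complete manifolds are complete); the end `e ≅ ℝ³ ∖ ball` is simply connected, so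
`p⁻¹(e)` is two copies of it, giving two DR ends of `Y` of the same mass `M`, one of them `e'`,
whose far regions cover `Y` up to the compact set `p⁻¹((e.far ρ)ᶜ)`. Size L (covering spaces,
pull-back of data; `AFEndCovering`, `InitialDataPullback` patterns). -/
theorem stub_orientationCover :
    ∀ (X : Type) [TopologicalSpace X] [ChartedSpace E3 X] [IsManifold (𝓡 3) ∞ X] [T2Space X]
      [SecondCountableTopology X] [ConnectedSpace X], ¬ IsOrientable (𝓡 3) X →
      ∀ d ∈ admissibleVacuumData X, ∀ (e : AFEnd X) (M : ℝ), e.IsSoleEnd →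
        e.IsStronglyAsymptoticallyFlatDR d M →
        ∃ (Y : Type) (_ : TopologicalSpace Y) (_ : ChartedSpace E3 Y) (_ : IsManifold (𝓡 3) ∞ Y)
          (_ : T2Space Y) (_ : SecondCountableTopology Y) (_ : ConnectedSpace Y),
          IsOrientable (𝓡 3) Y ∧
          ∃ (D' : InitialDataSet (𝓡 3) Y) (e' : AFEnd Y) (p : Y → X),
            IsCoveringMap p ∧ ContMDiff (𝓡 3) (𝓡 3) ∞ p ∧
            (∀ (y : Y) (v w : TangentSpace (𝓡 3) y),
              D'.h.inner y v w = d.h.inner (p y) (mfderiv (𝓡 3) (𝓡 3) p y v)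
                (mfderiv (𝓡 3) (𝓡 3) p y w)) ∧
            (∀ (y : Y) (v w : TangentSpace (𝓡 3) y),
              D'.k y v w = d.k (p y) (mfderiv (𝓡 3) (𝓡 3) p y v) (mfderiv (𝓡 3) (𝓡 3) p y w)) ∧
            (∀ [D'.metric.HasLeviCivita], D'.IsVacuumConstraintSolution ∧ D'.IsComplete) ∧
            e'.IsStronglyAsymptoticallyFlatDR D' M ∧ HasFinitelyManyDREnds D' e' := by
  sorry

/-! ## §3 Composition: the three stubs prove the crux BY NAME -/

/-- **The crux from the stubs**: case split on orientability of the carrier. Orientable: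
`stub_alignedFrame` supplies the frame, the sole end is the case `m = 0` of
`HasFinitelyManyDREnds`, and `stub_framedWitten` gives `0 ≤ M`. Non-orientable:
`stub_orientationCover` moves the datum to the orientation double cover (orientable, two DR ends
of mass `M`), where `stub_alignedFrame` and `stub_framedWitten` apply. -/
theorem AdmissibleMassNonneg_of :
    (∀ (X : Type) [TopologicalSpace X] [ChartedSpace E3 X] [IsManifold (𝓡 3) ∞ X] [T2Space X]
      [SecondCountableTopology X] [ConnectedSpace X],
      IsOrientable (𝓡 3) X → ∀ (D : InitialDataSet (𝓡 3) X) (e : AFEnd X) (M : ℝ),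
        e.IsStronglyAsymptoticallyFlatDR D M →
          ∃ F : Fin 3 → Π x : X, TangentSpace (𝓡 3) x,
            IsSmoothOrthonormalFrame D F ∧ IsAsymptoticallyCartesian e D F) →
    (∀ (X : Type) [TopologicalSpace X] [ChartedSpace E3 X] [IsManifold (𝓡 3) ∞ X] [T2Space X]
      [SecondCountableTopology X] [ConnectedSpace X]
      (D : InitialDataSet (𝓡 3) X) (e : AFEnd X) (M : ℝ)
      (F : Fin 3 → Π x : X, TangentSpace (𝓡 3) x),
      (∀ [D.metric.HasLeviCivita], D.IsVacuumConstraintSolution ∧ D.IsComplete) →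
        e.IsStronglyAsymptoticallyFlatDR D M → HasFinitelyManyDREnds D e →
          IsSmoothOrthonormalFrame D F → IsAsymptoticallyCartesian e D F → 0 ≤ M) →
    (∀ (X : Type) [TopologicalSpace X] [ChartedSpace E3 X] [IsManifold (𝓡 3) ∞ X] [T2Space X]
      [SecondCountableTopology X] [ConnectedSpace X], ¬ IsOrientable (𝓡 3) X →
      ∀ d ∈ admissibleVacuumData X, ∀ (e : AFEnd X) (M : ℝ), e.IsSoleEnd →
        e.IsStronglyAsymptoticallyFlatDR d M →
        ∃ (Y : Type) (_ : TopologicalSpace Y) (_ : ChartedSpace E3 Y) (_ : IsManifold (𝓡 3) ∞ Y)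
          (_ : T2Space Y) (_ : SecondCountableTopology Y) (_ : ConnectedSpace Y),
          IsOrientable (𝓡 3) Y ∧
          ∃ (D' : InitialDataSet (𝓡 3) Y) (e' : AFEnd Y) (p : Y → X),
            IsCoveringMap p ∧ ContMDiff (𝓡 3) (𝓡 3) ∞ p ∧
            (∀ (y : Y) (v w : TangentSpace (𝓡 3) y),
              D'.h.inner y v w = d.h.inner (p y) (mfderiv (𝓡 3) (𝓡 3) p y v)
                (mfderiv (𝓡 3) (𝓡 3) p y w)) ∧
            (∀ (y : Y) (v w : TangentSpace (𝓡 3) y),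
              D'.k y v w = d.k (p y) (mfderiv (𝓡 3) (𝓡 3) p y v) (mfderiv (𝓡 3) (𝓡 3) p y w)) ∧
            (∀ [D'.metric.HasLeviCivita], D'.IsVacuumConstraintSolution ∧ D'.IsComplete) ∧
            e'.IsStronglyAsymptoticallyFlatDR D' M ∧ HasFinitelyManyDREnds D' e') →
    Summit.FinalStateConjecture.FinalStateConjecture.Theses.ExactKerrEnds.AdmissibleMassNonneg := by
  intro hframe hwitten hcover X _ _ _ _ _ _ d hd e M hsole hDR
  by_cases hor : IsOrientable (𝓡 3) X
  · obtain ⟨F, hF, hcart⟩ := hframe X hor d e M hDR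
    exact hwitten X d e M F hd.1 hDR (hasFinitelyManyDREnds_of_isSoleEnd hsole hDR) hF hcart
  · obtain ⟨Y, _, _, _, _, _, _, hYor, D', e', p, -, -, -, -, hD', hDR', hends⟩ :=
      hcover X hor d hd e M hsole hDR
    obtain ⟨F, hF, hcart⟩ := hframe Y hYor D' e' M hDR'
    exact hwitten Y D' e' M F hD' hDR' hends hF hcart

/-- The same composition, phrased with the stubs themselves (audit convenience). -/
theorem AdmissibleMassNonneg_of_stubs :
    Summit.FinalStateConjecture.FinalStateConjecture.Theses.ExactKerrEnds.AdmissibleMassNonneg :=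
  AdmissibleMassNonneg_of stub_alignedFrame stub_framedWitten stub_orientationCover


/-! ## §4 Architecture of `stub_framedWitten` — the lead's first lemmas as NAMED STATEMENTS
(not registered stubs, no `sorry`): spinors trivialised by the frame (Parker–Taubes 1982, §2–§3).
Conventions: `V = ℂ²`; Dirac spinors along `X` are `S = V × V` (the splitting by the Hermitian
structure `e⁰·`, p. 226); `eʲ·(ξ, η) = (iσⱼξ, -iσⱼη)` (skew-Hermitian, `eʲ·eᵏ· + eᵏ·eʲ· = -2δⱼₖ`),
`e⁰·(ξ, η) = (η, ξ)` (Hermitian, `(e⁰·)² = 1`, anticommuting with the `eʲ·`); the Riemannian spin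
connection of the frame `∇ᵢ = Fᵢ + ¼ ∑ ω_{ijk} eʲ·eᵏ·`, `ω_{ijk} = h(∇_{Fᵢ}Fⱼ, Fₖ)`; the
hypersurface connection `∇̂ᵢ = ∇ᵢ - ½ ∑ⱼ k_{ij} e⁰·eʲ·` (proof of Prop. 5.1) and `𝒟 = ∑ᵢ eⁱ·∇̂ᵢ`.
Statement (a) below is where the lead validates these sign conventions first (a symbolic
computation); (b) is Thm. 4.1 (i)+(iii) in vacuum on a DR end; (c) is Lemma 4.3 (a) in `L²` form;
`nonneg_of_massIdentity` is the elementary last step. -/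

namespace Architecture

/-- Two-component spinors `V = ℂ²` (Parker–Taubes 1982, §2). -/
abbrev V : Type := Fin 2 → ℂ

/-- Dirac spinors along the hypersurface, `S ≅ V × V` (Parker–Taubes 1982, §2, p. 226). -/
abbrev Spinor : Type := V × V

/-- The Pauli matrices `σ₁, σ₂, σ₃`. [folklore] -/
def pauli : Fin 3 → Matrix (Fin 2) (Fin 2) ℂ
  | 0 => !![0, 1; 1, 0]
  | 1 => !![0, -Complex.I; Complex.I, 0]
  | 2 => !![1, 0; 0, -1]

/-- Clifford multiplication by the `j`-th (spacelike, unit) frame vector: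
`eʲ·(ξ, η) = (iσⱼ ξ, -iσⱼ η)`. [folklore] -/
def cl (j : Fin 3) (ψ : Spinor) : Spinor :=
  (Complex.I • (pauli j).mulVec ψ.1, -(Complex.I • (pauli j).mulVec ψ.2))

/-- Clifford multiplication by the future unit normal: `e⁰·(ξ, η) = (η, ξ)`. [folklore] -/
def cl0 (ψ : Spinor) : Spinor := (ψ.2, ψ.1)

/-- The positive-definite Hermitian square norm `⟨ψ, ψ⟩ = |ξ|² + |η|²` (Parker–Taubes 1982,
p. 226, the inner product `⟨ , ⟩`). [folklore] -/
def normSq (ψ : Spinor) : ℝ := ∑ A, (‖ψ.1 A‖ ^ 2 + ‖ψ.2 A‖ ^ 2)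

theorem normSq_nonneg (ψ : Spinor) : 0 ≤ normSq ψ :=
  Finset.sum_nonneg fun _ _ ↦ by positivity

variable {X : Type} [TopologicalSpace X] [ChartedSpace E3 X] [IsManifold (𝓡 3) ∞ X]
  (D : InitialDataSet (𝓡 3) X) (F : Fin 3 → Π x : X, TangentSpace (𝓡 3) x)

/-- Connection coefficients of the frame, `ω_{ijk}(x) = h_x(∇_{Fᵢ} Fⱼ, Fₖ)` (Levi-Civita
connection of `h`; Mathlib argument order `∇ Y x v = ∇_v Y`). [folklore] -/
def omega [D.metric.HasLeviCivita] (i j k : Fin 3) (x : X) : ℝ :=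
  D.h.inner x (D.metric.leviCivita (F j) x (F i x)) (F k x)

/-- Frame components of the second fundamental form, `k_{ij}(x) = k_x(Fᵢ, Fⱼ)`. [folklore] -/
def kFrame (i j : Fin 3) (x : X) : ℝ := D.k x (F i x) (F j x)

/-- Frame derivative of a spinor field (a `V × V`-valued function): `(Fᵢψ)(x) = dψ_x(Fᵢ(x))`.
[folklore] -/
def frameDeriv (i : Fin 3) (ψ : X → Spinor) (x : X) : Spinor :=
  mfderiv (𝓡 3) 𝓘(ℝ, Spinor) ψ x (F i x)

/-- The hypersurface (Sen–Witten) spin covariant derivative in the frame: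
`∇̂ᵢψ = Fᵢψ + ¼ ∑_{j,k} ω_{ijk} eʲ·eᵏ·ψ - ½ ∑ⱼ k_{ij} e⁰·eʲ·ψ` (Parker–Taubes 1982, §3 and proof
of Prop. 5.1). [folklore] -/
def nablaHat [D.metric.HasLeviCivita] (i : Fin 3) (ψ : X → Spinor) (x : X) : Spinor :=
  frameDeriv F i ψ x
    + (1 / 4 : ℝ) • ∑ j, ∑ k, omega D F i j k x • cl j (cl k (ψ x))
    - (1 / 2 : ℝ) • ∑ j, kFrame D F i j x • cl0 (cl j (ψ x))

/-- The hypersurface Dirac operator `𝒟ψ = ∑ᵢ eⁱ·∇̂ᵢψ` (Parker–Taubes 1982, §3). [folklore] -/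
def diracWitten [D.metric.HasLeviCivita] (ψ : X → Spinor) (x : X) : Spinor :=
  ∑ i, cl i (nablaHat D F i ψ x)

variable [T2Space X] [LocallyCompactSpace X] [MeasurableSpace X] [BorelSpace X]

/-- **(a) The vacuum Weitzenböck identity** (Parker–Taubes 1982, (3.1)–(3.2) with `ℛ = 0`: in
vacuum `R + 2R₀₀ = 2G₀₀ = 16πμ = 0` and `R₀ᵢ = 8πJᵢ = 0` by the constraint equations, and a
compactly supported spinor has no boundary term): for smooth compactly supported `φ`,
`∫ |𝒟φ|² dV_h = ∫ ∑ᵢ |∇̂ᵢφ|² dV_h`. To be proved under: `D` solves the vacuum constraints, `F` is a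
smooth `h`-orthonormal frame. First lemma of the line (validates the conventions above).
[folklore] -/
def WeitzenbockVacuum [D.metric.HasLeviCivita] : Prop :=
  ∀ φ : X → Spinor, ContMDiff (𝓡 3) 𝓘(ℝ, Spinor) ∞ φ → HasCompactSupport φ →
    ∫ x, normSq (diracWitten D F φ x) ∂(riemannianMeasure D.h) =
      ∫ x, ∑ i, normSq (nablaHat D F i φ x) ∂(riemannianMeasure D.h)

/-- **(b) Witten's harmonic spinor with the mass identity** (Parker–Taubes 1982, Thm. 4.1 (i) and
(iii), eq. (4.1), in vacuum on a DR end of mass `M`: `E = M`, `P = 0`): for the constant spinor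
`ψ₀` there is a smooth solution of `𝒟ψ = 0` with square-integrable `∇̂ψ` (asymptotic to `ψ₀` on
`e` and to `0` on the other ends) whose energy is `∫ ∑ᵢ |∇̂ᵢψ|² dV_h = 4π M |ψ₀|²`. To be proved
under the hypotheses of `stub_framedWitten`, from (a), weighted Poincaré/Hardy coercivity and
Lax–Milgram in the completion of `C_c^∞` (Thm. 4.2, `p = 2`, `δ = -1`), the vanishing lemma (c),
and the boundary-flux computation (4.3)–(4.5) in the asymptotically Cartesian frame. [folklore] -/
def WittenMassIdentity [D.metric.HasLeviCivita] (M : ℝ) (ψ₀ : Spinor) : Prop :=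
  ∃ ψ : X → Spinor, ContMDiff (𝓡 3) 𝓘(ℝ, Spinor) ∞ ψ ∧ (∀ x, diracWitten D F ψ x = 0) ∧
    MeasureTheory.Integrable (fun x ↦ ∑ i, normSq (nablaHat D F i ψ x)) (riemannianMeasure D.h) ∧
    ∫ x, ∑ i, normSq (nablaHat D F i ψ x) ∂(riemannianMeasure D.h) = 4 * Real.pi * M * normSq ψ₀

/-- **(c) The vanishing lemma** (Parker–Taubes 1982, Lemma 4.3 (a), `L²` form): a smooth
`∇̂`-parallel spinor which is square integrable vanishes identically (`|d log |Ψ|| ≤ C|k|`,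
`k = o(r⁻²)`, so `|Ψ|` is bounded below on the infinite-volume end unless `Ψ ≡ 0`; connectedness).
Used to show that the `L²` obstruction `Ψ = 𝒟(ψ₀ε + ξ)` of the Lax–Milgram step is zero.
[folklore] -/
def ParallelL2Vanishing [D.metric.HasLeviCivita] : Prop :=
  ∀ Ψ : X → Spinor, ContMDiff (𝓡 3) 𝓘(ℝ, Spinor) ∞ Ψ → (∀ i x, nablaHat D F i Ψ x = 0) →
    MeasureTheory.Integrable (fun x ↦ normSq (Ψ x)) (riemannianMeasure D.h) → ∀ x, Ψ x = 0

/-- **The elementary last step**: the mass identity for one non-zero constant spinor gives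
`0 ≤ M`, because the energy is an integral of a non-negative function. [folklore] -/
theorem nonneg_of_massIdentity [D.metric.HasLeviCivita] {M : ℝ} {ψ₀ : Spinor}
    (hψ₀ : normSq ψ₀ ≠ 0) (h : WittenMassIdentity D F M ψ₀) : 0 ≤ M := by
  obtain ⟨ψ, -, -, -, hE⟩ := h
  have hint : 0 ≤ ∫ x, ∑ i, normSq (nablaHat D F i ψ x) ∂(riemannianMeasure D.h) :=
    MeasureTheory.integral_nonneg fun x ↦ Finset.sum_nonneg fun i _ ↦ normSq_nonneg _
  rw [hE] at hint
  have hpos : 0 < 4 * Real.pi * normSq ψ₀ := by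
    have := normSq_nonneg ψ₀
    positivity
  by_contra hM
  push Not at hM
  have : 4 * Real.pi * M * normSq ψ₀ < 0 := by
    have h1 : 4 * Real.pi * M * normSq ψ₀ = M * (4 * Real.pi * normSq ψ₀) := by ring
    rw [h1]
    exact mul_neg_of_neg_of_pos hM hpos
  linarith

end Architecture

end Summit.FinalStateConjecture.FinalStateConjecture.Cruxes.AdmissibleMassNonneg.FramedWitten

end
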